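import Literature.NumberTheory.NumberFields.UnramifiedHomsClassGroupPRankBoundSharp
import Literature.NumberTheory.NumberFields.KummerRankUnramifiedOutsidePCMExtension
import HarnessLib

/-!
# Homomorphisms on an open normal subgroup of `Γ_K` with values in a `p`-torsion group that kill the inertia
# groups AWAY FROM `p`: the Kummer–reflection count `#T ≤ #M ^ (1 + s + v_p #C⁻_L[p])` over a totally real fixed field
# (proved; no definition, no named fact)

`Proofs`-style file in topic `NumberTheory/NumberFields` (namespace
`Literature.NumberTheory.NumberFields.UnramifiedOutsidePHomsKummerBound`), written by the prover seat `bsd-eis-lam-a`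
g20 (cell `bsd-eis`; `--supports` stmt-BirchSwinnertonDyer-19035, crux 5 `MazurMCOnX1RankZero`, registered stub
`stub_publishedL59` = Greenberg LNM 1716 Lemma 5.9; closes nothing).  It is the variant of
`UnramifiedHomsClassGroupPRankBoundSharp.card_le_pow_padicValNat_index_of_unramified` (seat `bsd-potss-rkm` g34, whose
§0–§3 are followed line by line) in which the maps are only required to kill the inertia groups of the primes NOT
above `p` — the local condition of Greenberg's `H¹(ℚ_Σ/ℚ_∞, Θ)` with `Σ = {p, ∞}` — and the class-field-theoretic count
of unramified extensions is replaced by the Kummer–reflection count of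
`CMExtension.natCard_aut_le_of_forall_inertia_eq_one` (Lang Ch. 13 Thm. 2.1 (i) with ramification above `p` allowed).

**Theorem** (`card_le_pow_of_inertia_away`).  `K` a number field, `p` an odd prime, `U ≤ Γ_K` open normal with fixed
field `F = K̄^U`, `W ≤ U` open and normal in `Γ_K`, `M` a finite abelian group with `p·M = 0`, and `L` a CM number field
containing a primitive `p`-th root of unity with a ring isomorphism `F ≃ L⁺` (so `L/F` is a CM extension).  Every finite set `T` of
maps `g : U → M` that are additive, kill `W` and kill `U ∩ I_𝔓` for every maximal ideal `𝔓` of `\bar ℤ_K` NOT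
containing `p` has `#T ≤ #M ^ (1 + s + v_p #(Cl_L[p] ∩ ker N_{L/L⁺}))`, `s` = the number of primes of `𝓞_L` above `p`.

Proof: §1 `U' = W · [U,U] · U^p · ⟨U ∩ I_𝔓 : 𝔓 ∌ p⟩ ≤ U` is normal in `Γ_K` (the inertia family is stable under
conjugation, `I_{γ𝔓} = γ I_𝔓 γ⁻¹`) and killed by every `g`; §2 `E' = K̄^{U'}` is finite Galois over `F`, with
`G = Gal(E'/F)` abelian of exponent `p`; §3 the inertia groups of `G` at the maximal `Q ∌ p` of `𝓞_{E'}` are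
restrictions of absolute inertia groups `I_𝔓`, `𝔓 ∌ p` (tree `inertia_comap_ringOfIntegers_eq_map_absRestrictNormalHom`),
hence trivial; §4 the Kummer bound gives `#G ≤ p^{1+s} · #C`, `C = Cl_L[p] ∩ ker N` of order `p^c`, so `G` is
generated by `≤ 1 + s + c` elements and the descended maps, being additive, are determined there.

References: [GreenbergLNM1716] §5 Lemma 5.9 (proof, pp. 143–144); [Lang1990] Ch. 13 §2 Thm. 2.1;
[Washington1997] §13.3; [SerreLocalFields1979] Ch. I §7 Prop. 22 (b); [NeukirchANT1999] Ch. I §9 (9.4).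
-/

set_option autoImplicit false

noncomputable section

open scoped Classical Pointwise NumberField
open NumberField IsDedekindDomain Field IntermediateField

namespace Literature.NumberTheory.NumberFields.UnramifiedOutsidePHomsKummerBound

open Literature.NumberTheory.EllipticCurves Literature.NumberTheory.GaloisRepresentations
  Literature.NumberTheory.NumberFields Literature.NumberTheory.NumberFields.UnramifiedHomsClassGroupPRankBoundSharp

variable {K : Type} [Field K] [NumberField K]

/-! ## §0 Helpers -/

/-- An additive map `g` from a group to an abelian group killed by `p` has a kernel SUBGROUP containing the
commutators and the `p`-th powers (as in the sibling file). [folklore] -/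
private theorem exists_ker_subgroup {G : Type*} [Group G] {M : Type*} [AddCommGroup M]
    (p : ℕ) (hpM : ∀ m : M, p • m = 0) (g : G → M) (hadd : ∀ u v, g (u * v) = g u + g v) :
    ∃ Z : Subgroup G, (∀ x, x ∈ Z ↔ g x = 0) ∧ ⁅(⊤ : Subgroup G), ⊤⁆ ≤ Z ∧
      Subgroup.closure (Set.range fun u : G => u ^ p) ≤ Z := by
  let ĝ : G →* Multiplicative M :=
    { toFun := fun u => Multiplicative.ofAdd (g u)
      map_one' := by
        have h := hadd 1 1
        rw [mul_one, left_eq_add] at h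
        rw [h]; rfl
      map_mul' := fun a b => by rw [hadd, ofAdd_add] }
  refine ⟨ĝ.ker, fun x => ?_, ?_, ?_⟩
  · rw [MonoidHom.mem_ker]
    exact ⟨fun h => Multiplicative.ofAdd.injective h, fun h => by
      change Multiplicative.ofAdd (g x) = 1
      rw [h]; rfl⟩
  · intro y hy
    rw [← commutator_def] at hy
    exact Abelianization.commutator_subset_ker ĝ hy
  · rw [Subgroup.closure_le]
    rintro _ ⟨y, rfl⟩
    rw [SetLike.mem_coe, MonoidHom.mem_ker, map_pow]
    change Multiplicative.ofAdd (g y) ^ p = 1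
    rw [← ofAdd_nsmul, hpM]; rfl

omit [NumberField K] in
/-- A prime of `\bar ℤ_K` above a given maximal ideal of `𝓞 L`, for a number field `L ⊆ K̄` (integrality of `\bar ℤ_K`
over `𝓞 L`); it is maximal (as in the sibling file). [folklore] -/
private theorem exists_isMaximal_comap_ringOfIntegersToIntegralClosure_eq
    (L : IntermediateField K (AlgebraicClosure K)) (Q : Ideal (𝓞 L)) [hQ : Q.IsMaximal] :
    ∃ 𝔓 : Ideal (absIntegers (𝓞 K) K), 𝔓.IsMaximal ∧
      𝔓.comap (EllipticCurves.ringOfIntegersToIntegralClosure (k := K)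
        (Ω := AlgebraicClosure K) L) = Q := by
  set φ : 𝓞 L →+* absIntegers (𝓞 K) K :=
    EllipticCurves.ringOfIntegersToIntegralClosure (k := K) (Ω := AlgebraicClosure K) L with hφ
  letI : Algebra (𝓞 L) (absIntegers (𝓞 K) K) := φ.toAlgebra
  haveI : IsScalarTower (𝓞 K) (𝓞 L) (absIntegers (𝓞 K) K) :=
    IsScalarTower.of_algebraMap_eq fun x ↦ rfl
  haveI : Algebra.IsIntegral (𝓞 L) (absIntegers (𝓞 K) K) :=
    ⟨fun x ↦ (Algebra.IsIntegral.isIntegral (R := 𝓞 K) x).tower_top⟩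
  obtain ⟨𝔓, -, h𝔓prime, h𝔓Q⟩ := Ideal.exists_ideal_over_prime_of_isIntegral Q
    (⊥ : Ideal (absIntegers (𝓞 K) K))
    (fun x hx ↦ by
      rw [Ideal.mem_comap, Ideal.mem_bot] at hx
      have hx0 : x = 0 :=
        EllipticCurves.ringOfIntegersToIntegralClosure_injective L (hx.trans (map_zero _).symm)
      rw [hx0]
      exact Q.zero_mem)
  haveI := h𝔓prime
  refine ⟨𝔓, Ideal.isMaximal_of_isIntegral_of_isMaximal_comap (R := 𝓞 L) 𝔓 ?_, h𝔓Q⟩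
  rw [h𝔓Q]
  exact hQ

omit [NumberField K] in
/-- `I_{τ • 𝔓} ⊇ τ I_𝔓 τ⁻¹` (conjugation of inertia groups). [cite: NeukirchANT1999, Ch. I §9 (9.4)] -/
private theorem conj_mem_inertia_smul {B G : Type*} [CommRing B] [Group G] [MulSemiringAction G B]
    (𝔓 : Ideal B) (τ g : G) (hg : g ∈ 𝔓.inertia G) : τ * g * τ⁻¹ ∈ (τ • 𝔓).inertia G := by
  intro x
  have h1 : (τ * g * τ⁻¹) • x - x = τ • (g • (τ⁻¹ • x) - τ⁻¹ • x) := by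
    rw [smul_sub, ← mul_smul, ← mul_smul, smul_inv_smul]
  change (τ * g * τ⁻¹) • x - x ∈ τ • 𝔓
  rw [h1]
  exact Ideal.smul_mem_pointwise_smul_iff.mpr (hg (τ⁻¹ • x))

/-! ## §1 The subgroup `U' = W · [U,U] · U^p · ⟨U ∩ I_𝔓 : 𝔓 ∌ p⟩` -/

section Main

variable (p : ℕ) [Fact p.Prime]
  (U : Subgroup (absoluteGaloisGroup K)) [hUn : U.Normal]
  (W : Subgroup (absoluteGaloisGroup K)) [hWn : W.Normal]

omit [NumberField K] [Fact p.Prime] in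
/-- The subgroup of `U` generated (inside `U`) by `W ∩ U`, the commutators, the `p`-th powers and the traces
`U ∩ I_𝔓` of the inertia groups of the primes `𝔓 ∌ p` of `\bar ℤ_K`, pushed to `Γ_K`, is normal in `Γ_K` (each
generating piece is stable under conjugation; `I_{γ𝔓} = γ I_𝔓 γ⁻¹` and `γ𝔓 ∌ p`). [cite: NeukirchANT1999, Ch. I §9 (9.4)]
[folklore] -/
private theorem map_subtype_sup_normal :
    ((W.subgroupOf U ⊔ ⁅(⊤ : Subgroup U), ⊤⁆ ⊔ Subgroup.closure (Set.range fun u : U => u ^ p) ⊔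
      ⨆ (𝔓 : {𝔓 : Ideal (absIntegers (𝓞 K) K) //
          𝔓.IsMaximal ∧ ((p : ℕ) : absIntegers (𝓞 K) K) ∉ 𝔓}),
        (𝔓.1.inertia (absoluteGaloisGroup K)).subgroupOf U).map U.subtype).Normal := by
  set S : Subgroup U := W.subgroupOf U ⊔ ⁅(⊤ : Subgroup U), ⊤⁆ ⊔
    Subgroup.closure (Set.range fun u : U => u ^ p) ⊔
      ⨆ (𝔓 : {𝔓 : Ideal (absIntegers (𝓞 K) K) //
          𝔓.IsMaximal ∧ ((p : ℕ) : absIntegers (𝓞 K) K) ∉ 𝔓}),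
        (𝔓.1.inertia (absoluteGaloisGroup K)).subgroupOf U with hS
  have hstab : ∀ γ : absoluteGaloisGroup K, S.map (MulAut.conjNormal γ : U ≃* U).toMonoidHom ≤ S := by
    intro γ
    rw [hS, Subgroup.map_sup, Subgroup.map_sup, Subgroup.map_sup]
    refine sup_le (sup_le (sup_le ?_ ?_) ?_) ?_
    · rintro _ ⟨x, hx, rfl⟩
      have hxW : (x : absoluteGaloisGroup K) ∈ W := Subgroup.mem_subgroupOf.1 hx
      refine Subgroup.mem_sup_left (Subgroup.mem_sup_left (Subgroup.mem_sup_left (Subgroup.mem_subgroupOf.2 ?_)))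
      change (((MulAut.conjNormal γ : U ≃* U) x : U) : absoluteGaloisGroup K) ∈ W
      rw [MulAut.conjNormal_apply]
      exact hWn.conj_mem _ hxW γ
    · rw [Subgroup.map_commutator]
      exact (Subgroup.commutator_mono le_top le_top).trans
        (le_sup_right.trans (le_sup_left.trans le_sup_left))
    · rw [MonoidHom.map_closure]
      refine (Subgroup.closure_mono ?_).trans (le_sup_right.trans le_sup_left)
      rintro _ ⟨_, ⟨u, rfl⟩, rfl⟩
      exact ⟨(MulAut.conjNormal γ : U ≃* U) u, (map_pow _ u p).symm⟩
    · rw [Subgroup.map_iSup]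
      refine iSup_le fun 𝔓 => ?_
      rintro _ ⟨x, hx, rfl⟩
      have hxI : (x : absoluteGaloisGroup K) ∈ 𝔓.1.inertia (absoluteGaloisGroup K) := Subgroup.mem_subgroupOf.1 hx
      haveI : 𝔓.1.IsMaximal := 𝔓.2.1
      have hγ𝔓 : (γ • 𝔓.1).IsMaximal ∧ ((p : ℕ) : absIntegers (𝓞 K) K) ∉ γ • 𝔓.1 := by
        refine ⟨?_, fun hmem => 𝔓.2.2 ?_⟩
        · rw [Ideal.pointwise_smul_eq_comap]
          exact Ideal.comap_isMaximal_of_surjective _ (MulSemiringAction.toRingAut _ _ γ).symm.surjective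
        · rw [Ideal.mem_pointwise_smul_iff_inv_smul_mem] at hmem
          have e1 : γ⁻¹ • ((p : ℕ) : absIntegers (𝓞 K) K) = ((p : ℕ) : absIntegers (𝓞 K) K) :=
            map_natCast (MulSemiringAction.toRingHom _ _ γ⁻¹) p
          rw [e1] at hmem
          exact hmem
      refine Subgroup.mem_sup_right (Subgroup.mem_iSup_of_mem ⟨γ • 𝔓.1, hγ𝔓⟩ (Subgroup.mem_subgroupOf.2 ?_))
      change (((MulAut.conjNormal γ : U ≃* U) x : U) : absoluteGaloisGroup K) ∈
        (γ • 𝔓.1).inertia (absoluteGaloisGroup K)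
      rw [MulAut.conjNormal_apply]
      exact conj_mem_inertia_smul 𝔓.1 γ _ hxI
  refine ⟨fun n hn γ => ?_⟩
  obtain ⟨x, hx, rfl⟩ := hn
  have hmem : (MulAut.conjNormal γ : U ≃* U) x ∈ S := hstab γ ⟨x, hx, rfl⟩
  refine ⟨(MulAut.conjNormal γ : U ≃* U) x, hmem, ?_⟩
  rw [Subgroup.coe_subtype, MulAut.conjNormal_apply]

omit [NumberField K] [Fact p.Prime] in
/-- Additive maps out of a group into an abelian group that agree on a generating set agree everywhere (as in the
sibling file). [folklore] -/
private theorem eq_of_eqOn_closure_eq_top {G : Type*} [Group G] {M : Type*} [AddCommGroup M]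
    {s : Set G} (hs : Subgroup.closure s = ⊤) {f g : G → M}
    (hf : ∀ a b, f (a * b) = f a + f b) (hg : ∀ a b, g (a * b) = g a + g b)
    (h : Set.EqOn f g s) : f = g := by
  have hf1 : f 1 = 0 := by
    have h1 := hf 1 1
    rw [mul_one, left_eq_add] at h1
    exact h1
  have hg1 : g 1 = 0 := by
    have h1 := hg 1 1
    rw [mul_one, left_eq_add] at h1
    exact h1
  let F : G →* Multiplicative M :=
    { toFun := fun u => Multiplicative.ofAdd (f u)
      map_one' := by rw [hf1]; rfl
      map_mul' := fun a b => by rw [hf, ofAdd_add] }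
  let G' : G →* Multiplicative M :=
    { toFun := fun u => Multiplicative.ofAdd (g u)
      map_one' := by rw [hg1]; rfl
      map_mul' := fun a b => by rw [hg, ofAdd_add] }
  have hFG : F = G' := MonoidHom.eq_of_eqOn_dense hs (fun x hx => by
    change Multiplicative.ofAdd (f x) = Multiplicative.ofAdd (g x)
    rw [h hx])
  funext u
  have := congrArg (fun φ : G →* Multiplicative M => (φ u).toAdd) hFG
  exact this

/-! ## §2–§4 The count -/

/-- **Kummer–reflection count for homomorphisms unramified outside `p`.**  `K` a number field, `p` an odd prime,
`U ≤ Γ_K` open normal with fixed field `F = K̄^U`, `W ≤ U` open and normal in `Γ_K`, `M` a finite abelian group with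
`p·M = 0`, `L` a CM number field containing a primitive `p`-th root of unity `ζ` together with a ring isomorphism
`F ≃ L⁺` onto its maximal real subfield (so `F` is totally real and `L/F` is a CM extension).  A finite set `T` of maps `g : U → M` that are additive, kill `W` and kill
`U ∩ I_𝔓` for every maximal ideal `𝔓` of `\bar ℤ_K` NOT containing `p` has
**`#T ≤ #M ^ (1 + s + v_p #(Cl_L[p] ∩ ker N_{L/L⁺}))`**, `s` the number of primes of `𝓞_L` containing `p`: all `g`
factor through additive maps on `G = Gal(E'/F)`, `E' = K̄^{U'}`, an abelian extension of exponent `p` unramified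
outside `p`, whose order the reflection bound `CMExtension.natCard_aut_le_of_forall_inertia_eq_one` controls.
[cite: GreenbergLNM1716, §5 Lemma 5.9 (proof, pp. 143–144)] [cite: Lang1990, Ch. 13 §2 Thm. 2.1 (i)]
[cite: SerreLocalFields1979, Ch. I §7 Prop. 22(b)] -/
theorem card_le_pow_of_inertia_away (hp2 : p ≠ 2)
    (hU : IsOpen (U : Set (absoluteGaloisGroup K)))
    (hW : IsOpen (W : Set (absoluteGaloisGroup K))) (hWU : W ≤ U)
    (L : Type) [Field L] [NumberField L] [IsCMField L]
    (eL : (fixedField U : IntermediateField K (AlgebraicClosure K)) ≃+* maximalRealSubfield L)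
    {ζ : L} (hζ : IsPrimitiveRoot ζ p)
    (M : Type) [AddCommGroup M] [Finite M] (hpM : ∀ m : M, p • m = 0)
    (T : Finset (U → M))
    (hadd : ∀ g ∈ T, ∀ u v : U, g (u * v) = g u + g v)
    (hW0 : ∀ g ∈ T, ∀ u : U, (u : absoluteGaloisGroup K) ∈ W → g u = 0)
    (hI0 : ∀ g ∈ T, ∀ (𝔓 : Ideal (absIntegers (𝓞 K) K)), 𝔓.IsMaximal →
      ((p : ℕ) : absIntegers (𝓞 K) K) ∉ 𝔓 →
      ∀ u : U, (u : absoluteGaloisGroup K) ∈ 𝔓.inertia (absoluteGaloisGroup K) → g u = 0) :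
    T.card ≤ Nat.card M ^ (1 + Nat.card {v : HeightOneSpectrum (𝓞 L) // ((p : ℕ) : 𝓞 L) ∈ v.asIdeal} +
      padicValNat p (Nat.card ↥((powMonoidHom p : ClassGroup (𝓞 L) →* ClassGroup (𝓞 L)).ker ⊓
        (classGroupNorm (maximalRealSubfield L) L).ker))) := by
  have hpr : p.Prime := Fact.out
  haveI : Algebra.IsAlgebraic K (AlgebraicClosure K) := AlgebraicClosure.isAlgebraic K
  haveI : IsGalois K (AlgebraicClosure K) := {}
  have hres_apply : ∀ (E : IntermediateField K (AlgebraicClosure K)) [Normal K E]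
      (σ : absoluteGaloisGroup K) (y : E),
      ((absRestrictNormalHom E σ y : E) : AlgebraicClosure K) = σ • (y : AlgebraicClosure K) :=
    fun E _ σ y => AlgEquiv.restrictNormalHom_apply E _ y
  -- §1 the subgroup `U'`
  set S : Subgroup U := W.subgroupOf U ⊔ ⁅(⊤ : Subgroup U), ⊤⁆ ⊔
    Subgroup.closure (Set.range fun u : U => u ^ p) ⊔
      ⨆ (𝔓 : {𝔓 : Ideal (absIntegers (𝓞 K) K) //
          𝔓.IsMaximal ∧ ((p : ℕ) : absIntegers (𝓞 K) K) ∉ 𝔓}),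
        (𝔓.1.inertia (absoluteGaloisGroup K)).subgroupOf U with hS
  set U' : Subgroup (absoluteGaloisGroup K) := S.map U.subtype with hU'def
  haveI hU'n : U'.Normal := map_subtype_sup_normal p U W
  have hU'le : U' ≤ U := by
    rintro _ ⟨x, -, rfl⟩
    exact x.2
  have hWU' : W ≤ U' := by
    intro w hw
    exact ⟨⟨w, hWU hw⟩, Subgroup.mem_sup_left (Subgroup.mem_sup_left
      (Subgroup.mem_sup_left (Subgroup.mem_subgroupOf.2 hw))), rfl⟩
  have hIU' : ∀ (𝔓 : Ideal (absIntegers (𝓞 K) K)), 𝔓.IsMaximal → ((p : ℕ) : absIntegers (𝓞 K) K) ∉ 𝔓 →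
      ∀ u : U, (u : absoluteGaloisGroup K) ∈ 𝔓.inertia (absoluteGaloisGroup K) →
        (u : absoluteGaloisGroup K) ∈ U' := by
    intro 𝔓 h𝔓 hp𝔓 u hu
    refine ⟨u, Subgroup.mem_sup_right (Subgroup.mem_iSup_of_mem ⟨𝔓, h𝔓, hp𝔓⟩ (Subgroup.mem_subgroupOf.2 hu)), rfl⟩
  have hU'open : IsOpen (U' : Set (absoluteGaloisGroup K)) := Subgroup.isOpen_mono hWU' hW
  -- every `g ∈ T` kills `U'`
  have hkill : ∀ g ∈ T, ∀ u : U, (u : absoluteGaloisGroup K) ∈ U' → g u = 0 := by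
    intro g hg u hu
    obtain ⟨x, hx, hxu⟩ := hu
    have hxu' : x = u := Subtype.ext hxu
    subst hxu'
    obtain ⟨Z, hZ, hZc, hZp⟩ := exists_ker_subgroup p hpM g (hadd g hg)
    have hSZ : S ≤ Z := by
      refine sup_le (sup_le (sup_le (fun y hy => (hZ y).2 (hW0 g hg y (Subgroup.mem_subgroupOf.1 hy))) hZc) hZp) ?_
      refine iSup_le fun 𝔓 => fun y hy => (hZ y).2 ?_
      exact hI0 g hg 𝔓.1 𝔓.2.1 𝔓.2.2 y (Subgroup.mem_subgroupOf.1 hy)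
    exact (hZ x).1 (hSZ hx)
  -- §2 the fields `F = K̄^U ≤ E' = K̄^{U'}`
  set E' : IntermediateField K (AlgebraicClosure K) := fixedField U' with hE'def
  have hFU : (fixedField U : IntermediateField K (AlgebraicClosure K)).fixingSubgroup = U := fixingSubgroup_fixedField_of_isOpen U hU
  have hE'U' : E'.fixingSubgroup = U' := fixingSubgroup_fixedField_of_isOpen U' hU'open
  have hUiff : ∀ σ : absoluteGaloisGroup K, σ ∈ U ↔ ∀ x ∈ (fixedField U : IntermediateField K (AlgebraicClosure K)), σ • x = x := fun σ => by
    refine (SetLike.ext_iff.mp hFU σ).symm.trans ?_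
    exact IntermediateField.mem_fixingSubgroup_iff (fixedField U : IntermediateField K (AlgebraicClosure K)) (absoluteGaloisGroup.toAlgEquiv K σ)
  have hFE' : (fixedField U : IntermediateField K (AlgebraicClosure K)) ≤ E' := by
    rw [hE'def, IntermediateField.le_iff_le]
    intro σ hσ
    exact (SetLike.ext_iff.mp hFU σ).2 (hU'le hσ)
  haveI : FiniteDimensional K E' := finiteDimensional_fixedField_of_isOpen U' hU'open
  haveI : FiniteDimensional K (fixedField U : IntermediateField K (AlgebraicClosure K)) := finiteDimensional_fixedField_of_isOpen U hU
  haveI hE'gal : IsGalois K E' := by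
    rw [← InfiniteGalois.normal_iff_isGalois, hE'U']; exact hU'n
  haveI : NumberField E' := NumberField.of_module_finite K E'
  -- `F` as an intermediate field of `E'/K`
  set F' : IntermediateField K E' := IntermediateField.restrict hFE' with hF'def
  haveI : FiniteDimensional K F' := IntermediateField.finiteDimensional_left F'
  haveI : NumberField F' := NumberField.of_module_finite K F'
  haveI : IsGalois F' E' := IsGalois.tower_top_of_isGalois K F' E'
  haveI : FiniteDimensional F' E' := Module.Finite.of_restrictScalars_finite K F' E'
  have hmemU_of : ∀ (σ : absoluteGaloisGroup K) (τ : E' ≃ₐ[F'] E'),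
      absRestrictNormalHom E' σ = τ.restrictScalars K → σ ∈ U := by
    intro σ τ hσ
    rw [hUiff]
    intro x hx
    have hx' : (⟨x, hFE' hx⟩ : E') ∈ F' := (IntermediateField.mem_restrict hFE' _).2 hx
    have h1 := hres_apply E' σ ⟨x, hFE' hx⟩
    rw [hσ, AlgEquiv.restrictScalars_apply] at h1
    rw [← h1]
    exact congrArg (fun z : E' => (z : AlgebraicClosure K)) (τ.commutes ⟨_, hx'⟩)
  -- the restriction `π : U → Gal(E'/F')`
  have hres_mem : ∀ u : U, absRestrictNormalHom E' (u : absoluteGaloisGroup K) ∈ F'.fixingSubgroup := by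
    intro u
    rw [IntermediateField.mem_fixingSubgroup_iff]
    intro x hx
    apply Subtype.ext
    rw [hres_apply]
    exact (hUiff u).1 u.2 _ ((IntermediateField.mem_restrict hFE' x).1 hx)
  let π : U →* (E' ≃ₐ[F'] E') :=
    (IntermediateField.fixingSubgroupEquiv F').toMonoidHom.comp
      (((absRestrictNormalHom E').comp U.subtype).codRestrict F'.fixingSubgroup hres_mem)
  have hπ_restrictScalars : ∀ u : U, (π u).restrictScalars K =
      absRestrictNormalHom E' (u : absoluteGaloisGroup K) := fun u => rfl
  have hπ_surj : Function.Surjective π := by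
    intro τ
    obtain ⟨σ, hσ⟩ := absRestrictNormalHom_surjective E' (τ.restrictScalars K)
    refine ⟨⟨σ, hmemU_of σ τ hσ⟩, ?_⟩
    apply AlgEquiv.restrictScalars_injective K
    rw [hπ_restrictScalars]
    exact hσ
  have hker_π : ∀ u : U, π u = 1 → (u : absoluteGaloisGroup K) ∈ U' := by
    intro u hu
    have h1 : absRestrictNormalHom E' (u : absoluteGaloisGroup K) = 1 := by
      rw [← hπ_restrictScalars, hu]; exact AlgEquiv.ext fun _ => rfl
    rw [absRestrictNormalHom_eq_one_iff] at h1
    exact (SetLike.ext_iff.mp hE'U' _).1 h1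
  have hπ_eq_one : ∀ u : U, (u : absoluteGaloisGroup K) ∈ U' → π u = 1 := by
    intro u hu
    apply AlgEquiv.restrictScalars_injective K
    rw [hπ_restrictScalars]
    have h1 : absRestrictNormalHom E' (u : absoluteGaloisGroup K) = 1 :=
      (absRestrictNormalHom_eq_one_iff E' _).2 ((SetLike.ext_iff.mp hE'U' _).2 hu)
    rw [h1]
    exact AlgEquiv.ext fun _ => rfl
  have hfactor : ∀ g ∈ T, ∀ u₁ u₂ : U, π u₁ = π u₂ → g u₁ = g u₂ := by
    intro g hg u₁ u₂ h
    have h1 : π (u₂⁻¹ * u₁) = 1 := by rw [map_mul, map_inv, h, inv_mul_cancel]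
    have h2 := hkill g hg _ (hker_π _ h1)
    have h3 : g u₁ = g (u₂ * (u₂⁻¹ * u₁)) := by rw [mul_inv_cancel_left]
    rw [h3, hadd g hg, h2, add_zero]
  -- the descended maps `ḡ`
  let desc : (U → M) → ((E' ≃ₐ[F'] E') → M) := fun g τ => g (Function.surjInv hπ_surj τ)
  have hdesc : ∀ g ∈ T, ∀ u : U, desc g (π u) = g u := fun g hg u =>
    hfactor g hg _ _ (Function.surjInv_eq hπ_surj (π u))
  have hdesc_add : ∀ g ∈ T, ∀ a b, desc g (a * b) = desc g a + desc g b := by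
    intro g hg a b
    obtain ⟨x, rfl⟩ := hπ_surj a
    obtain ⟨y, rfl⟩ := hπ_surj b
    rw [← map_mul, hdesc g hg, hdesc g hg, hdesc g hg, hadd g hg]
  have hdesc_inj : Set.InjOn desc T := by
    intro g₁ hg₁ g₂ hg₂ h
    funext u
    rw [← hdesc g₁ hg₁ u, ← hdesc g₂ hg₂ u, h]
  -- `G = Gal(E'/F')` has exponent `p` and is commutative
  have hexp : ∀ τ : E' ≃ₐ[F'] E', τ ^ p = 1 := by
    intro τ
    obtain ⟨u, rfl⟩ := hπ_surj τ
    rw [← map_pow]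
    exact hπ_eq_one _ ⟨u ^ p, Subgroup.mem_sup_left (Subgroup.mem_sup_right
      (Subgroup.subset_closure ⟨u, rfl⟩)), rfl⟩
  haveI hGcomm : IsMulCommutative (E' ≃ₐ[F'] E') := by
    refine ⟨⟨fun a b => ?_⟩⟩
    obtain ⟨u, rfl⟩ := hπ_surj a
    obtain ⟨v, rfl⟩ := hπ_surj b
    have hc : π (u * v * u⁻¹ * v⁻¹) = 1 := by
      refine hπ_eq_one _ ⟨u * v * u⁻¹ * v⁻¹, ?_, rfl⟩
      refine Subgroup.mem_sup_left (Subgroup.mem_sup_left (Subgroup.mem_sup_right ?_))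
      rw [← commutatorElement_def]
      exact Subgroup.commutator_mem_commutator (Subgroup.mem_top u) (Subgroup.mem_top v)
    rw [map_mul, map_mul, map_mul, map_inv, map_inv, mul_inv_eq_one, mul_inv_eq_iff_eq_mul] at hc
    exact hc
  -- §3 the inertia groups of `G` at the primes `Q ∌ p` are trivial
  have hinert : ∀ (Q : Ideal (𝓞 E')) [Q.IsMaximal], ((p : ℕ) : 𝓞 E') ∉ Q →
      ∀ τ ∈ Q.inertia (E' ≃ₐ[F'] E'), τ = 1 := by
    intro Q hQ hpQ τ hτ
    obtain ⟨𝔓, h𝔓max, h𝔓Q⟩ := exists_isMaximal_comap_ringOfIntegersToIntegralClosure_eq E' Q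
    haveI := h𝔓max
    have hp𝔓 : ((p : ℕ) : absIntegers (𝓞 K) K) ∉ 𝔓 := by
      intro hmem
      apply hpQ
      rw [← h𝔓Q, Ideal.mem_comap]
      have e1 : (EllipticCurves.ringOfIntegersToIntegralClosure (k := K) (Ω := AlgebraicClosure K) E')
          ((p : ℕ) : 𝓞 E') = ((p : ℕ) : absIntegers (𝓞 K) K) := map_natCast _ p
      exact e1 ▸ hmem
    have hτK : τ.restrictScalars K ∈ Q.inertia (E' ≃ₐ[K] E') := by
      rw [AddSubgroup.mem_inertia] at hτ ⊢
      intro x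
      rw [RingOfIntegers.restrictScalars_smul]
      exact hτ x
    rw [← h𝔓Q, inertia_comap_ringOfIntegers_eq_map_absRestrictNormalHom E' 𝔓] at hτK
    obtain ⟨σ, hσI, hσ⟩ := hτK
    have hσU : σ ∈ U := hmemU_of σ τ hσ
    have hπσ : π ⟨σ, hσU⟩ = τ := by
      apply AlgEquiv.restrictScalars_injective K
      rw [hπ_restrictScalars]
      exact hσ
    rw [← hπσ]
    exact hπ_eq_one _ (hIU' 𝔓 h𝔓max hp𝔓 ⟨σ, hσU⟩ hσI)
  -- §4 the Kummer–reflection bound and the count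
  -- the ring isomorphism `F' ≃ L⁺`
  let e₀ : ((fixedField U : IntermediateField K (AlgebraicClosure K)) : Type) ≃ₐ[K] (F' : Type) :=
    IntermediateField.restrict_algEquiv hFE'
  let e' : (F' : Type) ≃+* maximalRealSubfield L := e₀.symm.toRingEquiv.trans eL
  have hGbound := IsCMField.natCard_aut_le_of_forall_inertia_eq_one_of_ringEquiv (F' : Type) L hpr hp2 hζ e'
    (E' : Type) hexp hinert
  -- `#C = p^c`
  set C := ((powMonoidHom p : ClassGroup (𝓞 L) →* ClassGroup (𝓞 L)).ker ⊓
      (classGroupNorm (maximalRealSubfield L) L).ker) with hCdef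
  have hCp : IsPGroup p C := by
    intro x
    refine ⟨1, Subtype.ext ?_⟩
    have hx : (x : ClassGroup (𝓞 L)) ∈ (powMonoidHom p : ClassGroup (𝓞 L) →* ClassGroup (𝓞 L)).ker :=
      (Subgroup.mem_inf.mp x.2).1
    rw [MonoidHom.mem_ker, powMonoidHom_apply] at hx
    rw [pow_one]
    exact hx
  obtain ⟨c, hc⟩ := hCp.exists_card_eq
  have hvc : padicValNat p (Nat.card C) = c := by rw [hc, padicValNat.prime_pow]
  set s := Nat.card {v : HeightOneSpectrum (𝓞 L) // ((p : ℕ) : 𝓞 L) ∈ v.asIdeal} with hsdef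
  -- generators of the `p`-group `G`
  have hG : IsPGroup p (E' ≃ₐ[F'] E') := fun τ => ⟨1, by rw [pow_one]; exact hexp τ⟩
  obtain ⟨gens, hgens, hgenscard⟩ := exists_finset_card_le_closure_eq_top_of_isPGroup p hG
  have hgens_le : gens.card ≤ 1 + s + c := by
    have h1 : p ^ gens.card ≤ p ^ (1 + s + c) := by
      calc p ^ gens.card ≤ Nat.card (E' ≃ₐ[F'] E') := hgenscard
        _ ≤ p ^ (1 + s) * Nat.card C := hGbound
        _ = p ^ (1 + s + c) := by rw [hc, ← pow_add]
    exact (Nat.pow_le_pow_iff_right hpr.one_lt).1 h1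
  -- counting: `T ↪ (gens → M)`
  have h1 : T.card ≤ Nat.card M ^ gens.card := by
    let ev : (U → M) → (↥(gens : Set (E' ≃ₐ[F'] E')) → M) := fun g x => desc g x.1
    have hinj : Function.Injective (fun g : (T : Set (U → M)) => ev g.1) := by
      rintro ⟨a, ha⟩ ⟨b, hb⟩ h
      apply Subtype.ext
      apply hdesc_inj ha hb
      refine eq_of_eqOn_closure_eq_top hgens (hdesc_add a ha) (hdesc_add b hb) fun x hx => ?_
      exact congrFun h ⟨x, hx⟩
    have hle := Nat.card_le_card_of_injective _ hinj
    rw [Nat.card_coe_set_eq, Set.ncard_coe_finset, Nat.card_fun, Nat.card_coe_set_eq,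
      Set.ncard_coe_finset] at hle
    exact hle
  have hMpos : 0 < Nat.card M := Nat.card_pos
  calc T.card ≤ Nat.card M ^ gens.card := h1
    _ ≤ Nat.card M ^ (1 + s + c) := Nat.pow_le_pow_right hMpos hgens_le
    _ = _ := by rw [hvc]

end Main

end Literature.NumberTheory.NumberFields.UnramifiedOutsidePHomsKummerBound

end
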